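import Summits.AnomalousDissipation.AnomalousDissipation.Theorems.QuarticGate.Negative.EnergyRow
import Summits.AnomalousDissipation.AnomalousDissipation.Theorems.QuarticGate.Negative.Laminar

/-!
# Disproof of `QuarticTightness` — findings of the standing adversary
(cdisprove, stmt-AnomalousDissipation-14331, route MomentParity, rank 5)

Crux (verbatim shape, `quarticTightness_iff` below is `Iff.rfl`):
`∀ f` smooth div-free mean-zero, `∀ ν_j > 0 → 0`, `∀ E`, `∀ ε > 0`,
  GATE HYPOTHESIS  `GateHyp f ν E ε`  (= the body of `QuarticGate` at these parameters:
  `∀ j ∃ᶠ N ∃ μ` level-`N`, `∫‖u‖⁴ < ∞`, 4-stationary, energy `≤ E`, dissipation `≥ ε`)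
  `→ ∃ E' ε' > 0`, LADDER CONCLUSION `LadderConcl f ν E' ε'` (= the body of `MomentLadder` minus the
  resolution clause = the body of `GalerkinInvariantLoud` graded by order:
  `∀ j ∃ R ∃ᶠ N ∀ d ∃ μ` level-`N`, supported in `‖u‖ ≤ R`, `d`-stationary, energy `≤ E'`,
  dissipation `≥ ε'`).

## Verdict (cycle 1): NO KILL — and a proof that no cheap kill exists

A refutation is a pair (f, ν) such that  (i) `GateHyp f ν E ε` HOLDS and (ii) `LadderConcl f ν E' ε'`
FAILS for all budgets. Both halves are research-level, for opposite reasons, and (ii) is BARRED from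
every known quietness technique by weak duality:

* (i) is the rank-2 crux `QuarticGate` at the chosen force: `quarticGate_of_not_quarticTightness :
  ¬ QuarticTightness → QuarticGate` (§A). No non-invariant 4-stationary loud family exists in the tree
  (its construction is line `recession-cone` of crux 11464, conjectural content = Casimir
  classification S2); the only `GateHyp`-witness families in the tree are `δ₀` at `f = 0` (quiet) and
  the laminar Kolmogorov Diracs (fully invariant, energy `∝ ν⁻²`). CONSEQUENCE: no variant of the crux
  that keeps `GateHyp` intact can be refuted today; the load-bearing table (§C) is necessarily short.
* (ii) says: along a subsequence of `ν_j → 0`, EVERY bounded-support Galerkin-invariant (all-order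
  stationary) level-`N` ensemble of the force `f` is quiet, uniformly in large `N`
  (`not_ladderConcl_iff`, `not_invariantFamily_of_not_ladderConcl`, §A/§B) — a 3-D "absence of
  turbulence at bounded energy" theorem for a force that nevertheless carries loud order-4 statistics.
  No nonzero 3-D force with such a theorem is known (Marchioro 1986 is 2-D, first shell, and works
  through the QUADRATIC Lyapunov function `Z − λ₁E`; in 3-D the quadratic Casimirs of the ball
  truncations are exactly `span{E, H}` with `H` indefinite — sibling cdisprove of 11464, exact mod-p
  computations — so no definite quadratic certificate exists).
* THE BARRIER (§E, `gateWitness_eps_le_of_cubicCertificate`, `not_gateHyp_of_cubicCertificates`):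
  by weak (Lagrangian) duality, any proof of (ii) that exhibits, at the quiet viscosity and all large
  levels, a CUBIC QUIETNESS CERTIFICATE — band tests `g`, a polynomial `P` of degree `≤ 3`, `λ ≥ 0`,
  `U < ε` with `ν‖∇u‖² + ⟨F(u), ∇p(u)⟩ + λ(E − |u|²) ≤ U` pointwise on level-`N` fields — kills the
  gate hypothesis (i) at the same (f, ν, E): `ε ≤ U`. Every uniform-laminarisation argument in print
  for Galerkin/NS ensembles (energy, enstrophy, helicity and mixed quadratic Lyapunov functions,
  Marchioro, background-flow = quadratic auxiliary functional, cubic auxiliary functionals of the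
  Tobasco–Goluskin–Doering / Fantuzzi–Goluskin programme) IS such a certificate of degree `≤ 3` (each in
  its own phase space; e.g. Alexakis–Doering is `V = (√ν/4)Z`, `λ = √ν`, `U = √ν(E + ‖Af‖²/8)` on T²).
  So a counterexample force needs a laminarisation mechanism INVISIBLE TO CUBIC AUXILIARY FUNCTIONALS
  (degree `≥ 4` or non-polynomial: trapping regions, LaSalle-type invariance arguments), N-uniformly in
  3-D. Nothing of the kind exists. This is why the crux resists, stated as a theorem.
* Conversely the crux itself is zeroth-law-hard: `QuarticTightness ∧ QuarticGate → ` a loud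
  Galerkin-invariant-type ladder for the gate's force (`ladderConcl_of_quarticTightness`), i.e. with the
  recession-cone programme it would deliver the converged-DNS zeroth law for Kolmogorov forcing. Open
  both ways; "probably true, cannot be broken cheaply" is the honest stamp.

## LANDED (cycle 1) — import these instead of re-proving
* p82387 ACCEPTED → `Theorems/QuarticTightness/Negative/CubicCertificateBarrier.lean` (§E below: `dissDensity`,
  `IsCubicCertificate`, `gateWitness_eps_le_of_cubicCertificate`, `not_gateHyp_of_cubicCertificates`,
  `gateWitness_eps_le_of_injectionCertificate`, `backgroundCertificateBound_holds`).
* p82556 ACCEPTED → `Theorems/QuarticTightness/Negative/Anatomy.lean` (vocabulary `IsLadderWitness`,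
  `IsInvariantWitness`, `GateHyp`, `LadderConcl`, `InvariantFamily`, `quarticTightness_iff`,
  `galerkinInvariantLoud_iff`; §A `not_quarticTightness_iff`, `not_ladderConcl_iff`,
  `ladderConcl_of_quarticTightness`; §B badges; §C `quarticTightness_false_without_epsPos`; §D floors;
  §F fixed-ν / j-dependent-E' trivialities).
This PUBLISHED copy stays SELF-CONTAINED (namespace `…Cruxes.QuarticTightness.Disproof`, same bodies as
the landed modules) so that it elaborates while the farm has not yet built the two new modules; the
import-based slim version (`Disproof_v2_imports.lean` in the seat folder: imports both landed modules and
keeps only the WORKFILE-only positive corollaries `quarticGate_of_not_quarticTightness`,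
`quarticTightness_of_not_quarticGate`, `quarticGate_of_galerkinInvariantLoud`,
`quarticTightness_trichotomy` plus the cross-file §E′ corollaries) replaces it at the next re-arm.
Ideators/planners: IMPORT the landed modules, not this file. The sibling seat of
`GalerkinInvariantLoud` (stmt-14283) landed the parallel vocabulary `IsGILWitness` in
`Theorems/GalerkinInvariantLoud/Negative/Clauses.lean` (= `IsInvariantWitness` here, same clauses).

## What IS proved (sorry-free; now in the two landed modules unless marked WORKFILE)
(A) SHAPE: `quarticTightness_iff`, `not_quarticTightness_iff`, `not_ladderConcl_iff`,
    `quarticGate_of_not_quarticTightness` (¬crux ⊢ QuarticGate), `ladderConcl_of_quarticTightness`.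
(B) BADGES: `IsInvariantWitness.isLadderWitness`, `ladderConcl_of_invariantFamily`,
    `not_invariantFamily_of_not_ladderConcl` (¬crux refutes the Galerkin-invariant loud family of its
    force), `IsLadderWitness.isQuarticWitness` (bounded support ⇒ fourth moments: the CONCLUSION implies
    the HYPOTHESIS, `gateHyp_of_ladderConcl`; the crux says the two badges are equivalent up to
    constants), `quarticGate_of_galerkinInvariantLoud`.
(C) LOAD-BEARING `0 < ε`: `quarticTightness_false_without_epsPos` (`f = 0`, `δ₀` carries the gate
    hypothesis with `ε = 0`; the ladder side can never be loud at `f = 0` by the energy row). Every other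
    clause needs a GateHyp-witness family to be tested — see the verdict.
(D) FLOORS ON THE LADDER SIDE (prover briefing): `IsLadderWitness.eps_le_force` (`ε' ≤ ‖f‖₂√E'`, so
    `E' ≥ (ε'/‖f‖₂)²`), `IsLadderWitness.eps_le` (`ε' ≤ 4π²N²ν_jE'`: levels escape like `ν_j^{-1/2}` on
    the conclusion side too), `IsLadderWitness.eps_le_radius` (`ε' ≤ ‖f‖₂ R`: the support radius is
    `≥ ε'/‖f‖₂`, and for genuine invariant laws `R ∼ ‖f‖₂/(4π²ν_j)` — R MUST depend on j),
    `not_ladderBoundedLevel`.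
(E) THE CUBIC-CERTIFICATE BARRIER: `IsCubicCertificate`, `gateWitness_eps_le_of_cubicCertificate`,
    `not_gateHyp_of_cubicCertificates`, `not_counterexample_of_cubicCertificates`.
(F) FIXED VISCOSITY IS TRIVIAL: `isLadderWitness_dirac_kolState` — for the Kolmogorov force `K_1` at any
    fixed `ν > 0` the laminar Dirac is BOTH a gate witness and a ladder witness at every order and level
    `≥ 1` (energy `(4π²ν)⁻²/2`); `ladderConcl_jDependentEnergy_kolmogorov` — with a `j`-DEPENDENT energy
    budget the conclusion holds outright along every `ν_j → 0` (uniform floor `(8π² sup ν)⁻¹`): the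
    content of the crux is the j-UNIFORMITY of `E'` as `ν_j → 0`.

## Attacks tried (cycle 1) — all dead, reasons in one line each
* junk hunt in the typed clauses (ensembleDissipation junk `ν·0` at infinite enstrophy, Bochner junk of
  ensembleEnergy, `m = 0`/`d = 0` rows, `N = 0` levels): none bites — loudness `≥ ε > 0` is junk-proof,
  `∃ᶠ N` discards small levels, bounded support makes every conclusion-side integrand integrable.
* degenerate forces: `f = 0` kills the hypothesis (energy row), so no counterexample; gradient / constant
  forces are not admissible or do no work (sibling `CubicParityLoud.Negative.Clauses`).
* fixed level / Taylor window: both sides obey the same level ceiling (D).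
* fixed viscosity: both sides hold (F); `Tendsto ν 0` cannot be shown load-bearing by a refutation (at
  constant ν the implication is true for K_1 here, and for every f ≠ 0 by steady Galerkin Diracs +
  H¹-compactness — sketch only).
* same-constants / levelwise strengthenings (E' = E, ε' = ε; ladder witness at the SAME level as each
  gate witness): need a non-invariant gate witness to test — none constructible (verdict, first bullet).
* 2-D shadow: on T² the gate hypothesis itself fails (`PlanarCubicQuiet`, Alexakis–Doering = a
  QUADRATIC certificate), consistent with (E): quadratic certificates kill both sides at once.
* hypotheses on `f` (paper-level): `IsDivFree f` / `HasZeroMean f` are COSMETIC — every row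
  `nsGeneratorPairing ν f u w` and both budgets see only the Leray projection `Pf` (`(f, w) = (Pf, w)` for
  solenoidal mean-zero band tests `w`), so the crux over all smooth `f` is equivalent to the crux as typed:
  neither load-bearing nor exploitable (not formalised; `Literature.Analysis.FluidPDE.LerayProjector`).
* literature for (ii): no 3-D uniform-laminarisation theorem for any nonzero force (searched: Marchioro
  1986/87, Constantin–Foias–Temam attractor dimension, Doering–Foias 2002 body-force bounds give
  `ε ≤ c₁νU²/ℓ² + c₂U³/ℓ` and `ε ≥ ν λ₁ U²`-type floors, never `ε → 0` at bounded energy).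

## Cross-references read at cycle 1 (what the other seats of this crux hold)
* Ideator cards `Cruxes/QuarticTightness/Ideas/`: `certificate-completeness` (ideator 3) reads the crux
  as COMPLETENESS of background-class certificates — its `BackgroundCertificateBound` is the degree-2
  case of §E's `gateWitness_eps_le_of_cubicCertificate`, PROVED here for degree ≤ 3;
  `casimir-gap-ladder` (ideator 1: `BoundedSupportSelfImprovement`, `LadderRung`, `SphereSignLemma`)
  — plausible future `-- Targets`; none is refutable today for the reason of the verdict (every
  gate-witness family in the tree is invariant or quiet, so a rung statement can only be tested on
  laminar Diracs, which pass); `saddle-saturation` (ideator 2) with kit jobs j012222 / j012481: cube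
  Kolmogorov Galerkin systems (|nᵢ| ≤ 10, 15), loud bounded episodes with ν-INDEPENDENT budgets
  (D ≈ 0.50–0.60, E ≈ 1.2–1.3, Re_vVG 40–130; `ToyResultsIdeator2.md`) — numerical support for the
  CONCLUSION at the gate's own force `sin(2πx₂)e₁`, i.e. evidence AGAINST a refutation there;
  `BarrierNotesIdeator2.md` B1–B4 (crux ⟺ universal Galerkin zeroth law modulo `recession-cone`;
  agrees with §A/§B here, which certify the logical skeleton: `gateHyp_of_ladderConcl`,
  `quarticGate_of_not_quarticTightness`, `not_invariantFamily_of_not_ladderConcl`).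
* In-tree strong duality `Literature.Dynamics.Ergodic.TobascoGoluskinDoering2018_measureForm_holds`
  (PROVED): at fixed `(j, N)`, "no loud bounded invariant law" ⟺ a `C¹` auxiliary-functional
  certificate on the absorbing ball. §E is the finite-degree weak-duality counterpart on the HYPOTHESIS
  side: a certificate of degree ≤ 3 kills the gate. The crux is exactly the gap between the two
  certificate classes (ball/`C¹` versus global/cubic), `N`-uniformly as `ν → 0`.
* Barrier catalogue `Literature/Barriers/AnomalousDissipation/`: `GravestModeLaminarAttractor*`
  (Marchioro 1986 = FMRT App. III.A.4, planar first-shell force: the laminarisation IS the degree-2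
  certificate `Z − λ₁E`, decaying at rate `16π²ν`) and `AlexakisDoering2006_energyDissipationBound`
  (planar, degree 2: enstrophy) are the two quietness theorems in the catalogue — both are cubic
  certificates in the sense of §E, both planar, neither survives vortex stretching in the 3-D phase
  space of the same force; `Cheskidov2023_thm13_not_forceRobustNoAnomaly` constrains NEGATIVE summit
  proofs, not this ∀-f crux (here the refuter chooses `f`). Negatives index (`ledger negatives`):
  DebrisQuanta 2859, FrustratedForces 2979/2984, TaylorCertificatePair 13037 — Leray–Hopf ceilings /
  Taylor-window certificates, no instance of either side of this crux.

## Targets (lead's stuck stubs): none posted (payload.targets = []).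
-/

namespace Summit.AnomalousDissipation.AnomalousDissipation.Cruxes.QuarticTightness.Disproof

set_option linter.dupNamespace false

open MeasureTheory Filter Topology
open scoped ENNReal InnerProductSpace RealInnerProductSpace
open Literature.Analysis.FunctionSpaces Literature.Analysis.FluidPDE
open Summit.AnomalousDissipation.AnomalousDissipation.Theses.MomentParity
open Summit.AnomalousDissipation.AnomalousDissipation.Theorems
open Summit.AnomalousDissipation.AnomalousDissipation.Theorems.QuarticGate.Negative

noncomputable section

-- Type abbreviations `T3 = T³`, `R3 = ℝ³`, `H3 = H`, `L2T3 = L²(T³; ℝ³)` are the sibling crux's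
-- (`Theorems/CubicParityLoud/Negative/Clauses.lean`).
open Summit.AnomalousDissipation.AnomalousDissipation.Theorems.CubicParityLoud.Negative (T3 R3 H3 L2T3)

/-! ## Vocabulary (verbatim clauses of `QuarticTightness`, named; gate side = `IsQuarticWitness`) -/

/-- Conclusion-side (ladder) witness at level `N`, support radius `R`, order `d`, budgets `E, ε`:
the verbatim clauses of the conclusion of `QuarticTightness` (= `MomentLadder` minus resolution). -/
def IsLadderWitness (f : T3 → R3) (ν : ℝ) (N : ℕ) (R : ℝ) (d : ℕ) (E ε : ℝ) (μ : Measure H3) : Prop :=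
  IsProbabilityMeasure μ ∧ (∀ᵐ u ∂μ, IsLevel N u) ∧ (∀ᵐ u ∂μ, ‖u‖ ≤ R) ∧
    IsPolyStationary ν f N d μ ∧ Torus.ensembleEnergy μ ≤ E ∧ ε ≤ Torus.ensembleDissipation ν μ

/-- Galerkin-INVARIANT loud witness (verbatim clauses of `GalerkinInvariantLoud`: all orders at once). -/
def IsInvariantWitness (f : T3 → R3) (ν : ℝ) (N : ℕ) (R E ε : ℝ) (μ : Measure H3) : Prop :=
  IsProbabilityMeasure μ ∧ (∀ᵐ u ∂μ, IsLevel N u) ∧ (∀ᵐ u ∂μ, ‖u‖ ≤ R) ∧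
    (∀ (m : ℕ) (g : Fin m → T3 → R3) (P : MvPolynomial (Fin m) ℝ), (∀ i, IsBandTest N (g i)) →
      Integrable (fun u => Torus.nsGeneratorPairing ν f u (polyGrad g P u)) μ ∧
        ∫ u, Torus.nsGeneratorPairing ν f u (polyGrad g P u) ∂μ = 0) ∧
    Torus.ensembleEnergy μ ≤ E ∧ ε ≤ Torus.ensembleDissipation ν μ

/-- The GATE HYPOTHESIS of the crux at `(f, ν, E, ε)`: the body of `QuarticGate`. -/
def GateHyp (f : T3 → R3) (ν : ℕ → ℝ) (E ε : ℝ) : Prop :=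
  ∀ j : ℕ, ∃ᶠ N in atTop, ∃ μ, IsQuarticWitness f (ν j) N E ε μ

/-- The LADDER CONCLUSION of the crux at `(f, ν, E, ε)`: the body of `MomentLadder` minus resolution. -/
def LadderConcl (f : T3 → R3) (ν : ℕ → ℝ) (E ε : ℝ) : Prop :=
  ∀ j : ℕ, ∃ R : ℝ, ∃ᶠ N in atTop, ∀ d : ℕ, ∃ μ, IsLadderWitness f (ν j) N R d E ε μ

/-- The Galerkin-invariant loud family at `(f, ν, E, ε)`: the body of `GalerkinInvariantLoud`. -/
def InvariantFamily (f : T3 → R3) (ν : ℕ → ℝ) (E ε : ℝ) : Prop :=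
  ∀ j : ℕ, ∃ R : ℝ, ∃ᶠ N in atTop, ∃ μ, IsInvariantWitness f (ν j) N R E ε μ

/-- `QuarticTightness` restated through the vocabulary (definitional unfolding, `Iff.rfl`). -/
theorem quarticTightness_iff :
    QuarticTightness ↔ ∀ f : T3 → R3, Torus.IsSmooth f → Torus.IsDivFree f → Torus.HasZeroMean f →
      ∀ (ν : ℕ → ℝ) (E ε : ℝ), (∀ j, 0 < ν j) → Tendsto ν atTop (𝓝 0) → 0 < ε →
      GateHyp f ν E ε → ∃ E' ε' : ℝ, 0 < ε' ∧ LadderConcl f ν E' ε' :=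
  Iff.rfl

/-- `GalerkinInvariantLoud` restated through the vocabulary (`Iff.rfl`). -/
theorem galerkinInvariantLoud_iff :
    GalerkinInvariantLoud ↔ ∃ f : T3 → R3, Torus.IsSmooth f ∧ Torus.IsDivFree f ∧ Torus.HasZeroMean f ∧
      ∃ (ν : ℕ → ℝ) (E ε : ℝ), (∀ j, 0 < ν j) ∧ Tendsto ν atTop (𝓝 0) ∧ 0 < ε ∧
      InvariantFamily f ν E ε :=
  Iff.rfl

/-! ## A. Shape: what a refutation must prove -/

/-- **`¬ QuarticTightness` unfolded**: a refutation is a force and a viscosity sequence carrying the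
gate hypothesis with NO loud ladder for any budgets. [folklore] -/
theorem not_quarticTightness_iff :
    ¬ QuarticTightness ↔ ∃ f : T3 → R3, Torus.IsSmooth f ∧ Torus.IsDivFree f ∧ Torus.HasZeroMean f ∧
      ∃ (ν : ℕ → ℝ) (E ε : ℝ), (∀ j, 0 < ν j) ∧ Tendsto ν atTop (𝓝 0) ∧ 0 < ε ∧
      GateHyp f ν E ε ∧ ∀ E' ε' : ℝ, 0 < ε' → ¬ LadderConcl f ν E' ε' := by
  rw [quarticTightness_iff]
  push Not
  rfl

/-- **No loud ladder, unfolded**: at some viscosity index, for every radius, for all but finitely many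
levels, some order admits no witness — UNIFORM-IN-`N` QUIETNESS of bounded Galerkin ensembles. [folklore] -/
theorem not_ladderConcl_iff {f : T3 → R3} {ν : ℕ → ℝ} {E ε : ℝ} :
    ¬ LadderConcl f ν E ε ↔
      ∃ j : ℕ, ∀ R : ℝ, ∀ᶠ N in atTop, ∃ d : ℕ, ∀ μ, ¬ IsLadderWitness f (ν j) N R d E ε μ := by
  simp only [LadderConcl, not_forall, not_exists, Filter.not_frequently]

/-- **ANY DISPROOF OF THIS CRUX PROVES THE RANK-2 CRUX `QuarticGate`** (the counterexample force
carries the gate hypothesis, which is the body of `QuarticGate`). [folklore] -/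
theorem quarticGate_of_not_quarticTightness (h : ¬ QuarticTightness) : QuarticGate := by
  obtain ⟨f, hfs, hfd, hfz, ν, E, ε, hν, hν0, hε, hH, -⟩ := not_quarticTightness_iff.1 h
  exact quarticGate_iff.2 ⟨f, hfs, hfd, hfz, ν, E, ε, hν, hν0, hε, hH⟩

/-- Equivalently: if `QuarticGate` is false the crux holds vacuously. [folklore] -/
theorem quarticTightness_of_not_quarticGate (h : ¬ QuarticGate) : QuarticTightness :=
  Classical.byContradiction fun h' => h (quarticGate_of_not_quarticTightness h')

/-- The crux applied to the gate's own force: `QuarticTightness ∧ QuarticGate` give a loud ladder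
(the zeroth-law-strength output the route wants; with `UniformResolution` it is `MomentLadder`). [folklore] -/
theorem ladderConcl_of_quarticTightness (h : QuarticTightness) (hG : QuarticGate) :
    ∃ f : T3 → R3, Torus.IsSmooth f ∧ Torus.IsDivFree f ∧ Torus.HasZeroMean f ∧
      ∃ (ν : ℕ → ℝ) (E ε : ℝ), (∀ j, 0 < ν j) ∧ Tendsto ν atTop (𝓝 0) ∧ 0 < ε ∧
      LadderConcl f ν E ε := by
  obtain ⟨f, hfs, hfd, hfz, ν, E, ε, hν, hν0, hε, hH⟩ := quarticGate_iff.1 hG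
  obtain ⟨E', ε', hε', hC⟩ := quarticTightness_iff.1 h f hfs hfd hfz ν E ε hν hν0 hε hH
  exact ⟨f, hfs, hfd, hfz, ν, E', ε', hν, hν0, hε', hC⟩

/-! ## B. Badges: invariant ⇒ ladder ⇒ gate (the conclusion implies the hypothesis) -/

/-- An invariant witness is a ladder witness at every order. [folklore] -/
theorem IsInvariantWitness.isLadderWitness {f : T3 → R3} {ν : ℝ} {N : ℕ} {R E ε : ℝ} {μ : Measure H3}
    (h : IsInvariantWitness f ν N R E ε μ) (d : ℕ) : IsLadderWitness f ν N R d E ε μ :=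
  ⟨h.1, h.2.1, h.2.2.1, fun m g P hg _ => h.2.2.2.1 m g P hg, h.2.2.2.2.1, h.2.2.2.2.2⟩

/-- A Galerkin-invariant loud family is a loud ladder (same budgets). [folklore] -/
theorem ladderConcl_of_invariantFamily {f : T3 → R3} {ν : ℕ → ℝ} {E ε : ℝ}
    (h : InvariantFamily f ν E ε) : LadderConcl f ν E ε := by
  intro j
  obtain ⟨R, hR⟩ := h j
  exact ⟨R, hR.mono fun N ⟨μ, hμ⟩ d => ⟨μ, hμ.isLadderWitness d⟩⟩

/-- **A disproof refutes the Galerkin-invariant loud family of its force** (for all budgets):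
the counterexample force has NO loud bounded Galerkin-invariant ensembles N-frequently along `ν_j`. [folklore] -/
theorem not_invariantFamily_of_not_ladderConcl {f : T3 → R3} {ν : ℕ → ℝ} {E ε : ℝ}
    (h : ¬ LadderConcl f ν E ε) : ¬ InvariantFamily f ν E ε :=
  fun h' => h (ladderConcl_of_invariantFamily h')

/-- Bounded support ⇒ all moments: `∀ᵐ ‖u‖ ≤ R` on a finite measure gives `‖u‖^p` integrable. [folklore] -/
theorem integrable_norm_pow_of_ae_le {μ : Measure H3} [IsFiniteMeasure μ] {R : ℝ}
    (h : ∀ᵐ u ∂μ, ‖u‖ ≤ R) (p : ℕ) : Integrable (fun u : H3 => ‖u‖ ^ p) μ := by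
  refine Integrable.mono' (integrable_const (max R 0 ^ p)) (continuous_norm.pow p).aestronglyMeasurable ?_
  filter_upwards [h] with u hu
  rw [Real.norm_eq_abs, abs_of_nonneg (by positivity)]
  exact pow_le_pow_left₀ (norm_nonneg _) (hu.trans (le_max_left _ _)) p

/-- **A ladder witness of order `≥ 4` IS a gate witness** (bounded support gives the fourth moment). [folklore] -/
theorem IsLadderWitness.isQuarticWitness {f : T3 → R3} {ν : ℝ} {N : ℕ} {R : ℝ} {d : ℕ} {E ε : ℝ}
    {μ : Measure H3} (h : IsLadderWitness f ν N R d E ε μ) (hd : 4 ≤ d) :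
    IsQuarticWitness f ν N E ε μ := by
  obtain ⟨hp, hl, hb, hs, hE, hD⟩ := h
  exact ⟨hp, hl, integrable_norm_pow_of_ae_le hb 4, hs.mono hd, hE, hD⟩

/-- **The conclusion implies the hypothesis** (same budgets): the crux asserts that the two badges
"loud order-4 pseudo-ensembles exist" and "loud bounded ensembles of every order exist" are EQUIVALENT
up to constants along `ν_j → 0`. [folklore] -/
theorem gateHyp_of_ladderConcl {f : T3 → R3} {ν : ℕ → ℝ} {E ε : ℝ} (h : LadderConcl f ν E ε) :
    GateHyp f ν E ε := by
  intro j
  obtain ⟨R, hR⟩ := h j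
  exact hR.mono fun N hN => by
    obtain ⟨μ, hμ⟩ := hN 4
    exact ⟨μ, hμ.isQuarticWitness le_rfl⟩

/-- `GalerkinInvariantLoud → QuarticGate` (the route header's "implies QuarticGate"). [folklore] -/
theorem quarticGate_of_galerkinInvariantLoud (h : GalerkinInvariantLoud) : QuarticGate := by
  obtain ⟨f, hfs, hfd, hfz, ν, E, ε, hν, hν0, hε, hI⟩ := galerkinInvariantLoud_iff.1 h
  exact quarticGate_iff.2 ⟨f, hfs, hfd, hfz, ν, E, ε, hν, hν0, hε,
    gateHyp_of_ladderConcl (ladderConcl_of_invariantFamily hI)⟩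

/-! ## C. Load-bearing `0 < ε` -/

/-- **Force floor on the ladder side**: a ladder witness of order `≥ 3` has `ε ≤ ‖f‖_{L²} √E`
(energy row + Cauchy–Schwarz; sibling `ensembleDissipation_le_of_polyStationary`). [folklore] -/
theorem IsLadderWitness.eps_le_force {f : T3 → R3} (hf : MemLp f 2 volume) {ν : ℝ} {N : ℕ} {R : ℝ}
    {d : ℕ} {E ε : ℝ} {μ : Measure H3} (h : IsLadderWitness f ν N R d E ε μ) (hd : 3 ≤ d) :
    ε ≤ Real.sqrt (∫ x, ‖f x‖ ^ 2) * Real.sqrt E := by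
  obtain ⟨hp, hl, hb, hs, hE, hD⟩ := h
  have h2 := integrable_norm_pow_of_ae_le hb 2
  calc ε ≤ Torus.ensembleDissipation ν μ := hD
    _ ≤ Real.sqrt (∫ x, ‖f x‖ ^ 2) * Real.sqrt (Torus.ensembleEnergy μ) :=
        ensembleDissipation_le_of_polyStationary f hf hl h2 hd hs
    _ ≤ Real.sqrt (∫ x, ‖f x‖ ^ 2) * Real.sqrt E := by gcongr

/-- **The zero force has no loud ladder** (any budgets, `ε > 0`). [folklore] -/
theorem not_ladderConcl_zero_force {ν : ℕ → ℝ} {E ε : ℝ} (hε : 0 < ε) :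
    ¬ LadderConcl (fun _ => 0) ν E ε := by
  intro h
  obtain ⟨R, hR⟩ := h 0
  obtain ⟨N, hN⟩ := hR.exists
  obtain ⟨μ, hμ⟩ := hN 3
  have := hμ.eps_le_force (memLp_const 0) le_rfl
  simp at this
  linarith

/-- WEAKENING (refuted): `QuarticTightness` without `0 < ε`. -/
def QuarticTightnessWithoutEpsPos : Prop :=
  ∀ f : T3 → R3, Torus.IsSmooth f → Torus.IsDivFree f → Torus.HasZeroMean f →
    ∀ (ν : ℕ → ℝ) (E ε : ℝ), (∀ j, 0 < ν j) → Tendsto ν atTop (𝓝 0) →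
    GateHyp f ν E ε → ∃ E' ε' : ℝ, 0 < ε' ∧ LadderConcl f ν E' ε'

/-- **`0 < ε` is load-bearing**: without it, `f = 0`, `ν_j = 1/(j+1)`, `E = ε = 0` and the Dirac mass
`δ₀` carry the gate hypothesis at every level (sibling `isQuarticWitness_dirac_zero`), while the zero
force has no loud ladder (energy row). The crux cannot manufacture loudness: any proof consumes
`ε > 0` through the energy row `ν∫‖∇u‖² = ∫(f,u)`. [folklore] -/
theorem quarticTightness_false_without_epsPos : ¬ QuarticTightnessWithoutEpsPos := by
  intro h
  have hzero : (Torus.realTrigPoly (∅ : Finset (Fin 3 → ℤ)) (0 : (Fin 3 → ℤ) → EuclideanSpace ℂ (Fin 3)))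
      = fun _ => 0 := Torus.realTrigPoly_zero ∅
  obtain ⟨E', ε', hε', hC⟩ := h (fun _ => 0) (Torus.isSmooth_const _)
    (by rw [← hzero]; exact Torus.isDivFree_realTrigPoly fun k hk => by simp at hk)
    (by simp [Torus.HasZeroMean]) (fun j => 1 / ((j : ℝ) + 1)) 0 0 (fun j => by positivity)
    tendsto_one_div_add_atTop_nhds_zero_nat
    (fun j => Frequently.of_forall fun N => ⟨_, isQuarticWitness_dirac_zero _ (by positivity) N⟩)
  exact not_ladderConcl_zero_force hε' hC

/-! ## D. Floors on the ladder side (briefing for provers of the crux) -/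

/-- **Level ceiling on the ladder side**: `ε ≤ 4π² N² ν E` for every ladder witness (any order `d`,
stationarity not used). [folklore] -/
theorem IsLadderWitness.eps_le {f : T3 → R3} {ν : ℝ} (hν : 0 ≤ ν) {N : ℕ} {R : ℝ} {d : ℕ} {E ε : ℝ}
    {μ : Measure H3} (h : IsLadderWitness f ν N R d E ε μ) : ε ≤ 4 * Real.pi ^ 2 * (N : ℝ) ^ 2 * ν * E := by
  obtain ⟨hp, hl, hb, -, hE, hD⟩ := h
  have hdiss := ensembleDissipation_le_of_level hν hl (integrable_norm_pow_of_ae_le hb 2)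
  have hE0 : 0 ≤ Torus.ensembleEnergy μ := integral_nonneg fun u => by positivity
  calc ε ≤ Torus.ensembleDissipation ν μ := hD
    _ ≤ 4 * Real.pi ^ 2 * (N : ℝ) ^ 2 * ν * Torus.ensembleEnergy μ := hdiss
    _ ≤ 4 * Real.pi ^ 2 * (N : ℝ) ^ 2 * ν * E := by gcongr

/-- **Radius floor**: a ladder witness of order `≥ 3` has `ε ≤ ‖f‖_{L²} R` — the support radius is
at least `ε/‖f‖₂`; for genuine invariant laws `R` is the absorbing radius `∼ ‖f‖₂/(4π²ν_j)`, so the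
`∃ R` of the conclusion must be allowed to depend on `j`. [folklore] -/
theorem IsLadderWitness.eps_le_radius {f : T3 → R3} (hf : MemLp f 2 volume) {ν : ℝ} {N : ℕ} {R : ℝ}
    {d : ℕ} {E ε : ℝ} {μ : Measure H3} (h : IsLadderWitness f ν N R d E ε μ) (hd : 3 ≤ d) :
    ε ≤ Real.sqrt (∫ x, ‖f x‖ ^ 2) * R := by
  obtain ⟨hp, hl, hb, hs, hE, hD⟩ := h
  have h2 := integrable_norm_pow_of_ae_le hb 2
  have hR : 0 ≤ R := by
    obtain ⟨u, hu⟩ := (hb.and (ae_of_all μ fun u => norm_nonneg u)).exists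
    exact hu.2.trans hu.1
  have hEn : Torus.ensembleEnergy μ ≤ R ^ 2 := by
    unfold Torus.ensembleEnergy
    calc ∫ u, ‖u‖ ^ 2 ∂μ ≤ ∫ _u, R ^ 2 ∂μ :=
          integral_mono_ae h2 (integrable_const _) (hb.mono fun u hu => by
            exact pow_le_pow_left₀ (norm_nonneg _) hu 2)
      _ = R ^ 2 := by simp
  calc ε ≤ Torus.ensembleDissipation ν μ := hD
    _ ≤ Real.sqrt (∫ x, ‖f x‖ ^ 2) * Real.sqrt (Torus.ensembleEnergy μ) :=
        ensembleDissipation_le_of_polyStationary f hf hl h2 hd hs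
    _ ≤ Real.sqrt (∫ x, ‖f x‖ ^ 2) * Real.sqrt (R ^ 2) := by gcongr
    _ = Real.sqrt (∫ x, ‖f x‖ ^ 2) * R := by rw [Real.sqrt_sq hR]

/-- At a FIXED level, ladder witnesses die eventually in `j` (any radius, any order). [folklore] -/
theorem eventually_not_isLadderWitness (f : T3 → R3) {ν : ℕ → ℝ} (hν : ∀ j, 0 < ν j)
    (hν0 : Tendsto ν atTop (𝓝 0)) (E : ℝ) {ε : ℝ} (hε : 0 < ε) (N : ℕ) :
    ∀ᶠ j in atTop, ∀ R d μ, ¬ IsLadderWitness f (ν j) N R d E ε μ := by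
  set C : ℝ := 4 * Real.pi ^ 2 * (N : ℝ) ^ 2 * max E 0 + 1 with hC
  have hCpos : 0 < C := by positivity
  have hev : ∀ᶠ j in atTop, ν j < ε / C := (tendsto_order.1 hν0).2 _ (div_pos hε hCpos)
  refine hev.mono fun j hj R d μ hw => ?_
  have h1 := hw.eps_le (hν j).le
  have h2 : 4 * Real.pi ^ 2 * (N : ℝ) ^ 2 * ν j * E ≤ ν j * (C - 1) := by
    have : 4 * Real.pi ^ 2 * (N : ℝ) ^ 2 * ν j * E ≤ 4 * Real.pi ^ 2 * (N : ℝ) ^ 2 * ν j * max E 0 := by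
      gcongr
      · exact mul_nonneg (by positivity) (hν j).le
      · exact le_max_left _ _
    rw [hC]; nlinarith [this]
  have h3 : ν j * (C - 1) < ε := by
    have := (lt_div_iff₀ hCpos).1 hj
    nlinarith [(hν j).le]
  linarith

/-- STRENGTHENING OF THE CONCLUSION (refuted unconditionally): a loud ladder with the level chosen
BEFORE `j` (even only frequently in `j`). So on the conclusion side, too, `N ≳ ν_j^{-1/2}`. [folklore] -/
theorem not_ladderBoundedLevel :
    ¬ ∃ (f : T3 → R3) (ν : ℕ → ℝ) (E ε : ℝ), (∀ j, 0 < ν j) ∧ Tendsto ν atTop (𝓝 0) ∧ 0 < ε ∧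
      ∃ (N : ℕ) (R : ℝ), ∃ᶠ j in atTop, ∃ d μ, IsLadderWitness f (ν j) N R d E ε μ := by
  rintro ⟨f, ν, E, ε, hν, hν0, hε, N, R, hfreq⟩
  obtain ⟨j, ⟨d, μ, hμ⟩, hno⟩ :=
    (hfreq.and_eventually (eventually_not_isLadderWitness f hν hν0 E hε N)).exists
  exact hno R d μ hμ

/-! ## E. The cubic-certificate barrier (weak duality): why no known quietness argument can refute the crux -/

/-- The dissipation density `‖∇u‖²₂` of (the representative of) `u ∈ H`, as a real number. -/
def dissDensity (u : H3) : ℝ := (Torus.eGradNormSq ((u : L2T3) : T3 → R3)).toReal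

/-- `dissDensity` is Borel measurable. [folklore] -/
theorem measurable_dissDensity : Measurable dissDensity :=
  Torus.measurable_eGradNormSq_coe.ennreal_toReal

/-- Bernstein, real form: `‖∇u‖² ≤ 4π²N²‖u‖²` on level-`N` fields. [folklore] -/
theorem dissDensity_le_of_isLevel {N : ℕ} {u : H3} (hu : IsLevel N u) :
    dissDensity u ≤ 4 * Real.pi ^ 2 * (N : ℝ) ^ 2 * ‖u‖ ^ 2 := by
  have h := CubicParityLoud.Negative.eGradNormSq_le_of_isLevel (N := N) (u := u) hu
  have := ENNReal.toReal_mono ENNReal.ofReal_ne_top h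
  rwa [ENNReal.toReal_ofReal (by positivity)] at this

/-- On a level-`N` law with finite mean energy the dissipation density is integrable. [folklore] -/
theorem integrable_dissDensity {N : ℕ} {μ : Measure H3} (hlev : ∀ᵐ u ∂μ, IsLevel N u)
    (h2 : Integrable (fun u : H3 => ‖u‖ ^ 2) μ) : Integrable dissDensity μ := by
  refine Integrable.mono' (h2.const_mul (4 * Real.pi ^ 2 * (N : ℝ) ^ 2))
    measurable_dissDensity.aestronglyMeasurable ?_
  filter_upwards [hlev] with u hu
  rw [Real.norm_eq_abs, abs_of_nonneg (show 0 ≤ dissDensity u from ENNReal.toReal_nonneg)]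
  exact dissDensity_le_of_isLevel hu

/-- **Dissipation as a Bochner integral** on level-`N` laws: `ensembleDissipation ν μ = ν ∫ ‖∇u‖² dμ`. [folklore] -/
theorem ensembleDissipation_eq_integral_dissDensity {ν : ℝ} {N : ℕ} {μ : Measure H3}
    (hlev : ∀ᵐ u ∂μ, IsLevel N u) :
    Torus.ensembleDissipation ν μ = ν * ∫ u, dissDensity u ∂μ := by
  unfold Torus.ensembleDissipation Torus.ensembleEnstrophy dissDensity
  rw [integral_toReal Torus.measurable_eGradNormSq_coe.aemeasurable
    (hlev.mono fun u hu => CubicParityLoud.Negative.eGradNormSq_lt_top_of_isLevel hu)]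

/-- A **CUBIC QUIETNESS CERTIFICATE** for the force `f` at viscosity `ν`, level `N`, energy budget
`E`, with value `U`: band tests `g`, a polynomial `P` of total degree `≤ 3` (so `p(u) = P((u,gᵢ))` is a
cubic auxiliary functional), a multiplier `λ ≥ 0` for the energy constraint, and the POINTWISE
inequality on level-`N` fields
`ν‖∇u‖² + ⟨F(u), ∇p(u)⟩ + λ (E − ‖u‖²) ≤ U`.
This is the Lagrangian-dual / auxiliary-functional ("background", sum-of-squares) form of a dissipation
bound for Galerkin NS restricted to degree `≤ 3`; every quadratic Lyapunov/Casimir argument (energy,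
enstrophy, helicity, Marchioro's `Z − λ₁E`, background flows) is the special case `deg P ≤ 2`. -/
def IsCubicCertificate (f : T3 → R3) (ν : ℝ) (N : ℕ) (E U : ℝ) {m : ℕ} (g : Fin m → T3 → R3)
    (P : MvPolynomial (Fin m) ℝ) (lam : ℝ) : Prop :=
  (∀ i, IsBandTest N (g i)) ∧ P.totalDegree + 1 ≤ 4 ∧ 0 ≤ lam ∧
    ∀ u : H3, IsLevel N u →
      ν * dissDensity u + Torus.nsGeneratorPairing ν f u (polyGrad g P u) + lam * (E - ‖u‖ ^ 2) ≤ U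

/-- **WEAK DUALITY: a cubic certificate bounds every gate witness** — if `(g, P, λ, U)` is a cubic
quietness certificate at `(f, ν, N, E)`, then every level-`N` 4-stationary law with `∫‖u‖⁴ < ∞`,
energy `≤ E` and dissipation `≥ ε` has `ε ≤ U`. (Integrate the pointwise inequality: the generator row of
the cubic observable `p` vanishes by 4-stationarity, the multiplier term is `≤ 0` by the energy budget.)
Hence any quietness theorem PROVED BY CUBIC CERTIFICATES kills the gate hypothesis together with the
ladder conclusion, and cannot produce a counterexample to `QuarticTightness`. [folklore] -/
theorem gateWitness_eps_le_of_cubicCertificate {f : T3 → R3} {ν : ℝ} {N : ℕ} {E ε U : ℝ}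
    {μ : Measure H3} (hw : IsQuarticWitness f ν N E ε μ) {m : ℕ} {g : Fin m → T3 → R3}
    {P : MvPolynomial (Fin m) ℝ} {lam : ℝ} (hc : IsCubicCertificate f ν N E U g P lam) : ε ≤ U := by
  obtain ⟨hprob, hlev, h4, hstat, hEn, hε⟩ := hw
  obtain ⟨hg, hP, hlam, hpt⟩ := hc
  have h2 : Integrable (fun u : H3 => ‖u‖ ^ 2) μ := integrable_norm_sq_of_norm_pow_four h4
  obtain ⟨hGI, hG0⟩ := hstat m g P hg hP
  have hDI : Integrable dissDensity μ := integrable_dissDensity hlev h2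
  have hM : Integrable (fun u : H3 => lam * (E - ‖u‖ ^ 2)) μ := ((integrable_const E).sub h2).const_mul lam
  have hνD : Integrable (fun u : H3 => ν * dissDensity u) μ := hDI.const_mul ν
  have hS1 : Integrable (fun u : H3 => ν * dissDensity u +
      Torus.nsGeneratorPairing ν f u (polyGrad g P u)) μ := hνD.add hGI
  have hS : Integrable (fun u : H3 => ν * dissDensity u +
      Torus.nsGeneratorPairing ν f u (polyGrad g P u) + lam * (E - ‖u‖ ^ 2)) μ := hS1.add hM
  have hint_le : ∫ u, (ν * dissDensity u + Torus.nsGeneratorPairing ν f u (polyGrad g P u) +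
      lam * (E - ‖u‖ ^ 2)) ∂μ ≤ ∫ _u, U ∂μ :=
    integral_mono_ae hS (integrable_const U) (hlev.mono fun u hu => hpt u hu)
  have hU : ∫ _u : H3, U ∂μ = U := by simp
  have hsplit : ∫ u, (ν * dissDensity u + Torus.nsGeneratorPairing ν f u (polyGrad g P u) +
      lam * (E - ‖u‖ ^ 2)) ∂μ = ν * ∫ u, dissDensity u ∂μ + 0 + lam * (E - ∫ u, ‖u‖ ^ 2 ∂μ) := by
    rw [integral_add hS1 hM, integral_add hνD hGI, integral_const_mul, hG0, integral_const_mul,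
      integral_sub (integrable_const E) h2]
    simp
  have hEn' : ∫ u, ‖u‖ ^ 2 ∂μ ≤ E := hEn
  have hdiss := ensembleDissipation_eq_integral_dissDensity (ν := ν) hlev
  have hmul : 0 ≤ lam * (E - ∫ u, ‖u‖ ^ 2 ∂μ) := mul_nonneg hlam (sub_nonneg.2 hEn')
  rw [hsplit, hU] at hint_le
  calc ε ≤ Torus.ensembleDissipation ν μ := hε
    _ = ν * ∫ u, dissDensity u ∂μ := hdiss
    _ ≤ U := by linarith

/-- **THE BARRIER FOR DISPROOFS.** Suppose quietness of the force `f` along `ν` at energy budget `E` is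
CERTIFIED AT DEGREE 3: for every target `ε' > 0` some viscosity index admits, at all but finitely many
levels, a cubic certificate of value `< ε'`. Then the gate hypothesis fails at `(f, ν, E, ε)` for every
`ε > 0` — so `(f, ν)` is not a counterexample to `QuarticTightness`, however quiet its invariant
ensembles are. A refutation needs a laminarisation mechanism invisible to cubic auxiliary functionals. [folklore] -/
theorem not_gateHyp_of_cubicCertificates {f : T3 → R3} {ν : ℕ → ℝ} {E ε : ℝ} (hε : 0 < ε)
    (hcert : ∀ ε' : ℝ, 0 < ε' → ∃ j : ℕ, ∀ᶠ N in atTop,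
      ∃ (U : ℝ) (m : ℕ) (g : Fin m → T3 → R3) (P : MvPolynomial (Fin m) ℝ) (lam : ℝ),
        U < ε' ∧ IsCubicCertificate f (ν j) N E U g P lam) :
    ¬ GateHyp f ν E ε := by
  intro hH
  obtain ⟨j, hj⟩ := hcert ε hε
  obtain ⟨N, ⟨μ, hμ⟩, U, m, g, P, lam, hU, hc⟩ := ((hH j).and_eventually hj).exists
  exact absurd (gateWitness_eps_le_of_cubicCertificate hμ hc) (not_le.2 hU)

/-- Corollary in the shape of `not_quarticTightness_iff`: a degree-3-certified force is never the `f`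
of a counterexample. [folklore] -/
theorem not_counterexample_of_cubicCertificates {f : T3 → R3} {ν : ℕ → ℝ} {E ε : ℝ} (hε : 0 < ε)
    (hcert : ∀ ε' : ℝ, 0 < ε' → ∃ j : ℕ, ∀ᶠ N in atTop,
      ∃ (U : ℝ) (m : ℕ) (g : Fin m → T3 → R3) (P : MvPolynomial (Fin m) ℝ) (lam : ℝ),
        U < ε' ∧ IsCubicCertificate f (ν j) N E U g P lam) :
    ¬ (GateHyp f ν E ε ∧ ∀ E' ε' : ℝ, 0 < ε' → ¬ LadderConcl f ν E' ε') :=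
  fun h => not_gateHyp_of_cubicCertificates hε hcert h.1

/-- The same duality on the LADDER side (order `≥ 4`): cubic certificates bound ladder witnesses too —
both badges die together under any degree-`≤ 3` quietness proof. [folklore] -/
theorem IsLadderWitness.eps_le_of_cubicCertificate {f : T3 → R3} {ν : ℝ} {N : ℕ} {R : ℝ} {d : ℕ}
    {E ε U : ℝ} {μ : Measure H3} (hw : IsLadderWitness f ν N R d E ε μ) (hd : 4 ≤ d) {m : ℕ}
    {g : Fin m → T3 → R3} {P : MvPolynomial (Fin m) ℝ} {lam : ℝ}
    (hc : IsCubicCertificate f ν N E U g P lam) : ε ≤ U :=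
  gateWitness_eps_le_of_cubicCertificate (hw.isQuarticWitness hd) hc

/-- **Injection form of weak duality (the `certificate-completeness` card's first lemma, proved, at
degree ≤ 3).** If on level-`N` fields `(u,f) − λ‖u‖² + ⟨F(u), ∇p(u)⟩ ≤ c` with `deg P ≤ 3`, `λ ≥ 0`, then
every gate witness has `ε ≤ c + λE`: integrate, kill the row by 4-stationarity, and use the energy row
`ensembleDissipation = ∫(u,f)dμ` (sibling `ensembleDissipation_eq_of_polyStationary`). This is
`Cruxes/QuarticTightness/Ideate3Sketch.lean :: BackgroundCertificateBound` with `P.totalDegree ≤ 2`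
relaxed to `≤ 3`. [folklore] -/
theorem gateWitness_eps_le_of_injectionCertificate {f : T3 → R3} (hf : MemLp f 2 volume) {ν : ℝ} {N : ℕ}
    {E ε c lam : ℝ} {μ : Measure H3} (hw : IsQuarticWitness f ν N E ε μ) {m : ℕ} {g : Fin m → T3 → R3}
    {P : MvPolynomial (Fin m) ℝ} (hg : ∀ i, IsBandTest N (g i)) (hP : P.totalDegree + 1 ≤ 4)
    (hlam : 0 ≤ lam)
    (hpt : ∀ u : H3, IsLevel N u →
      Torus.pairing u.1 f - lam * ‖u‖ ^ 2 + Torus.nsGeneratorPairing ν f u (polyGrad g P u) ≤ c) :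
    ε ≤ c + lam * E := by
  obtain ⟨hprob, hlev, h4, hstat, hEn, hε⟩ := hw
  have h2 : Integrable (fun u : H3 => ‖u‖ ^ 2) μ := integrable_norm_sq_of_norm_pow_four h4
  have h1 : Integrable (fun u : H3 => ‖u‖) μ := integrable_norm_of_norm_sq h2
  have hpI : Integrable (fun u : H3 => Torus.pairing u.1 f) μ :=
    CubicParityLoud.Negative.integrable_pairing hf h1
  obtain ⟨hGI, hG0⟩ := hstat m g P hg hP
  have hL : Integrable (fun u : H3 => lam * ‖u‖ ^ 2) μ := h2.const_mul lam
  have hS1 : Integrable (fun u : H3 => Torus.pairing u.1 f - lam * ‖u‖ ^ 2) μ := hpI.sub hL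
  have hS : Integrable (fun u : H3 => Torus.pairing u.1 f - lam * ‖u‖ ^ 2 +
      Torus.nsGeneratorPairing ν f u (polyGrad g P u)) μ := hS1.add hGI
  have hint_le : ∫ u, (Torus.pairing u.1 f - lam * ‖u‖ ^ 2 +
      Torus.nsGeneratorPairing ν f u (polyGrad g P u)) ∂μ ≤ ∫ _u, c ∂μ :=
    integral_mono_ae hS (integrable_const c) (hlev.mono fun u hu => hpt u hu)
  have hc : ∫ _u : H3, c ∂μ = c := by simp
  have hsplit : ∫ u, (Torus.pairing u.1 f - lam * ‖u‖ ^ 2 +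
      Torus.nsGeneratorPairing ν f u (polyGrad g P u)) ∂μ =
        ∫ u, Torus.pairing u.1 f ∂μ - lam * ∫ u, ‖u‖ ^ 2 ∂μ + 0 := by
    rw [integral_add hS1 hGI, integral_sub hpI hL, integral_const_mul, hG0]
  have hdiss : Torus.ensembleDissipation ν μ = ∫ u, Torus.pairing u.1 f ∂μ :=
    ensembleDissipation_eq_of_polyStationary f hf hlev h2 (by norm_num : (3 : ℕ) ≤ 4) hstat
  have hEn' : ∫ u, ‖u‖ ^ 2 ∂μ ≤ E := hEn
  rw [hsplit, hc] at hint_le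
  have hmul : lam * ∫ u, ‖u‖ ^ 2 ∂μ ≤ lam * E := mul_le_mul_of_nonneg_left hEn' hlam
  calc ε ≤ Torus.ensembleDissipation ν μ := hε
    _ = ∫ u, Torus.pairing u.1 f ∂μ := hdiss
    _ ≤ c + lam * E := by linarith

/-- The `certificate-completeness` card's `BackgroundCertificateBound` (verbatim shape, degree relaxed to
`≤ 3`), as a theorem. [folklore] -/
theorem backgroundCertificateBound_holds :
    ∀ (N m : ℕ) (g : Fin m → T3 → R3) (P : MvPolynomial (Fin m) ℝ) (ν : ℝ) (f : T3 → R3)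
      (lam c E ε : ℝ) (μ : Measure H3),
      0 < ν → 0 ≤ lam → Torus.IsSmooth f → (∀ i, IsBandTest N (g i)) → P.totalDegree ≤ 3 →
      (∀ u : H3, IsLevel N u →
        Torus.pairing u.1 f - lam * ‖u‖ ^ 2 + Torus.nsGeneratorPairing ν f u (polyGrad g P u) ≤ c) →
      IsQuarticWitness f ν N E ε μ → ε ≤ c + lam * E :=
  fun _ _ _ _ _ _ _ _ _ _ _ _ hlam hf hg hP hpt hw =>
    gateWitness_eps_le_of_injectionCertificate (hf.memLp 2) hw hg (by omega) hlam hpt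

/-! ## F. Fixed viscosity is trivial: the laminar Kolmogorov Dirac is a witness on BOTH sides -/

/-- **At fixed `ν > 0` the Kolmogorov force `K_1 = cos(2πx₁)e₀` carries a gate witness AND a ladder
witness of every order at every level `N ≥ 1`**: the laminar Dirac `δ_{K_a}`, `a = (4π²ν)⁻¹`, with
`R = ‖K_a‖_H`, `E = a²/2`, `ε = (8π²ν)⁻¹` (sibling `isQuarticWitness_dirac_kolState`,
`isPolyStationary_dirac_kolState`). The implication of the crux is therefore pointwise-in-`ν` trivial for
this force; its content is the `j`-uniform energy budget `E'` as `ν_j → 0` (here `E ∝ ν⁻²`). [folklore] -/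
theorem isLadderWitness_dirac_kolState {ν : ℝ} (hν : 0 < ν) {N : ℕ} (hN : 1 ≤ N) (d : ℕ) :
    IsLadderWitness (kolField 1) ν N ‖kolState (4 * Real.pi ^ 2 * ν)⁻¹‖ d
      ((4 * Real.pi ^ 2 * ν)⁻¹ ^ 2 / 2) (8 * Real.pi ^ 2 * ν)⁻¹
      (Measure.dirac (kolState (4 * Real.pi ^ 2 * ν)⁻¹)) := by
  haveI : MeasurableSingletonClass (Torus.energySpace (Fin 3)) :=
    OpensMeasurableSpace.toMeasurableSingletonClass
  obtain ⟨⟨hp, hl, -, hs, hE, hD⟩, -⟩ := isQuarticWitness_dirac_kolState hν hN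
  have hforce : kolField 1 = kolField (4 * Real.pi ^ 2 * ν * (4 * Real.pi ^ 2 * ν)⁻¹) := by
    rw [mul_inv_cancel₀ (by positivity)]
  refine ⟨hp, hl, ?_, ?_, hE, hD⟩
  · rw [ae_dirac_eq]; simp
  · rw [hforce]; exact isPolyStationary_dirac_kolState ν _ N d

/-- Monotonicity of the ladder clauses in the loudness floor. [folklore] -/
theorem IsLadderWitness.mono_eps {f : T3 → R3} {ν : ℝ} {N : ℕ} {R : ℝ} {d : ℕ} {E ε ε' : ℝ}
    {μ : Measure H3} (h : IsLadderWitness f ν N R d E ε μ) (hε : ε' ≤ ε) :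
    IsLadderWitness f ν N R d E ε' μ :=
  ⟨h.1, h.2.1, h.2.2.1, h.2.2.2.1, h.2.2.2.2.1, hε.trans h.2.2.2.2.2⟩

/-- **WEAKENING OF THE CONCLUSION that holds outright (hypothesis unused): `E'` allowed to depend on
`j`.** Along EVERY positive `ν_j → 0` the Kolmogorov force `K_1` has loud ladders of every order at every
level `N ≥ 1` with a `j`-UNIFORM floor `ε' = (8π² sup_j ν_j)⁻¹` but energies `E'_j = (4π²ν_j)⁻²/2 → ∞`
(laminar Diracs). So the `j`-uniform energy budget `E'` carries the entire content of the conclusion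
(cf. sibling `quarticGateWithoutEnergyCeiling_holds` on the hypothesis side). [folklore] -/
theorem ladderConcl_jDependentEnergy_kolmogorov {ν : ℕ → ℝ} (hν : ∀ j, 0 < ν j)
    (hν0 : Tendsto ν atTop (𝓝 0)) :
    ∃ ε' : ℝ, 0 < ε' ∧ ∀ j : ℕ, ∃ (E' R : ℝ), ∃ᶠ N in atTop, ∀ d : ℕ, ∃ μ,
      IsLadderWitness (kolField 1) (ν j) N R d E' ε' μ := by
  obtain ⟨M, hM⟩ := hν0.bddAbove_range
  have hM' : ∀ j, ν j ≤ M := fun j => hM ⟨j, rfl⟩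
  have hMpos : 0 < M := (hν 0).trans_le (hM' 0)
  have hpi : 0 < Real.pi := Real.pi_pos
  refine ⟨(8 * Real.pi ^ 2 * M)⁻¹, by positivity, fun j => ⟨_, _,
    (eventually_ge_atTop 1).frequently.mono fun N hN d =>
      ⟨_, (isLadderWitness_dirac_kolState (hν j) hN d).mono_eps ?_⟩⟩⟩
  have hνj := hν j
  exact inv_anti₀ (by positivity) (by nlinarith [hM' j, hpi])

/-- Hence, at a single fixed viscosity, gate hypothesis and ladder conclusion BOTH hold for `K_1`
(frequently — indeed eventually — in `N`). [folklore] -/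
theorem gate_and_ladder_kolmogorov_fixedViscosity {ν : ℝ} (hν : 0 < ν) :
    (∃ᶠ N in atTop, ∃ μ, IsQuarticWitness (kolField 1) ν N ((4 * Real.pi ^ 2 * ν)⁻¹ ^ 2 / 2)
        (8 * Real.pi ^ 2 * ν)⁻¹ μ) ∧
    (∃ R : ℝ, ∃ᶠ N in atTop, ∀ d : ℕ, ∃ μ, IsLadderWitness (kolField 1) ν N R d
        ((4 * Real.pi ^ 2 * ν)⁻¹ ^ 2 / 2) (8 * Real.pi ^ 2 * ν)⁻¹ μ) :=
  ⟨(eventually_ge_atTop 1).frequently.mono fun _ hN => ⟨_, (isQuarticWitness_dirac_kolState hν hN).1⟩,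
    ⟨_, (eventually_ge_atTop 1).frequently.mono fun _ hN d => ⟨_, isLadderWitness_dirac_kolState hν hN d⟩⟩⟩

end

end Summit.AnomalousDissipation.AnomalousDissipation.Cruxes.QuarticTightness.Disproof
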